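import Summits.CriticalPhenomena.PercolationContinuityZ3.Theorems.PercNearOneGluingAdditiveGluingDefectStabilityGen01
import Summits.CriticalPhenomena.PercolationContinuityZ3.Theorems.PercNearOneGluingAdditiveGluingDefectStabilitySocket
import Summits.CriticalPhenomena.PercolationContinuityZ3.Theorems.PercNearOneGluingNoHeavyLowerTailCSHPeelRelDefect
import Summits.CriticalPhenomena.PercolationContinuityZ3.Theorems.PercNearOneGluingNoHeavyQuantEffectiveTargetLemmaDefect
import HarnessLib

/-!
# Crux `PercNearOneGluing.AdditiveGluing` / `NoHeavyLowerTail`: the TOLERANCE CHAIN in tolerance-bearing form, from block (A)'s margin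
# onward — socket (graded), blocks (A)+(B) end to end from an ε-relative CSH, and the composition with Kozma–Nitzan's Lemma 10

Effectivity-audit lane `prim-rate` (seats audit-1 / audit-2 / audit-3), deliverable (b) (HOME/SUBSTITUTES.md §TOL, links inside (A), (A)→(B),
(B)→(D)); support file for the CLOSED cruxes (`--supports stmt-CriticalPhenomena-4575`); no definitions, no named facts, no sorries, standard
axioms; nothing here is used by the tree's proof of the cruxes (`η = ε = 0`).  One file for the three remaining links so that they land in one
farm build cycle (audit-1 gen 52).

WHY «tolerance-bearing» (audit-1 gen 12 / gen 52, precision (bb)/(bb′)).  The companions `…AdditiveGluingDefectStabilitySocket.lean` /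
`…DefectStabilityGen.lean` state their margin / (S5) / (GEN) hypotheses for ALL monotone `F ≥ 0` with ONE fixed `η`; the decoy-free margin
`CSH.s5dMargin p T r [] o v F` and the surplus are degree-1 homogeneous in `F` and every side condition is invariant under `F ↦ c • F`
(`c > 0`), so those binders are EQUIVALENT to their `η = 0` instances (the theorems record that the PROOFS carry `η` with constant 1, but as
statements they are corollaries of the exact chain).  Here the functional binder is RESTRICTED to monotone `F` with values in `[0,1]` — all
that segment 2 consumes ((AG-loc) instantiates (GEN) at `F = 1{b ∈ ·}`) and exactly what an approximate block (A) delivers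
(`CSH.Defect.s5dMargin_ge_of_csh_relDefect`, `…NoHeavyLowerTailCSHPeelRelDefect.lean`).
* `CSH.Defect.additiveGluing_card_defect_of_s5dMargin_defect01` (GRADED socket + segment 2): margin `≥ −η` at every NON-DEGENERATE weight for
  `|T| ≤ K` and `[0,1]`-valued monotone `F` ⟹ `μ_w(o ↔ A) − t − η ≤ μ_w(o ↔ b)` at EVERY weight for `|A| ≤ K + 1` (`t ≥ max_a μ_w(a ↮ b)`):
  the per-`F` socket `CSH.Defect.surplusTransfer_nondegenerate_of_s5dMargin_defect` and closure `CSH.Defect.surplusTransfer_of_nondegenerate_defect`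
  of the companion (used as they stand — they take the margin bound for the one `F` they conclude about), then
  `AGloc.Defect.gen_firstRank_of_surplusTransfer_defect01` ⟹ `…agloc_firstRank_of_gen_defect01` ⟹ `…additiveGluing_card_of_agloc_firstRank_defect`;
  constant 1 in front of `η`, uniformly in `n`, `|A|`, `w`, `F`; `…additiveGluing_defect_of_s5dMargin_defect01`: all sizes; `η = 0` `example`
  returning the crux `AdditiveGluing` from memo Theorem 2 (`CSH.s5dMargin_nonneg_of_csh`).
* `CSH.Defect.additiveGluing_of_csh_relDefect` (blocks (A)+(B) END TO END): IF at every finite size `n`, every NON-DEGENERATE weight `p` and all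
  admissible `(o, v, x, Y, D)` (the binder list of the tree's `CSH.additiveGluing_of_csh`) the conditioned slack hierarchy holds up to the RELATIVE
  tolerance `ε·μ_p(x ↮ Y)·∫_{x ↮ Y}(1 − f(C_x)) dμ_p` for every `[0,1]`-valued monotone functional `f` of the open edge cluster of `x`, THEN for
  every weighted finite graph, relay set `A`, observers `o, b` and `t ≥ max_a μ(a ↮ b)`:  `μ_w(o ↔ A) − t − 2ε·(|A| − 1) ≤ μ_w(o ↔ b)` —
  block (A)'s peel costs `2ε` per peeled relay (`|T| ≤ |A| − 1` relays are peeled before the socket), then constant 1: an approximate CSH is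
  paid for LINEARLY IN THE NUMBER OF RELAYS, the one place in blocks (A)–(B) where an approximate engine pays a size factor.
* `Quant.Defect.targetPropertyAt_of_s5dMarginDefect01` ((A)→(D) by name): margin `≥ −η` on `[0,1]`-valued `F` at non-degenerate weights
  (η UNIFORM in the relay-set size) + Kozma–Nitzan's scale hypotheses (a)–(e) ⟹ `TargetPropertyAt d p (7δ + η) δ H R` —
  `Quant.Defect.targetPropertyAt_of_additiveGluingDefect` (audit-3, Lemma 10 with an η-defective gluing) ∘ the first bullet; the tolerance-
  bearing twin of audit-2's `…NoHeavyQuantTargetPropertyOfMarginDefect.lean`; from an ε-relative CSH (`η = 2ε·(|A| − 1)`) it applies only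
  with an a-priori bound on `|A|`.
Kernel certificates first written by seat audit-2 (gens 13/15/16, scratch `DefectStabilityG16b.lean`, rc 0 2026-08-22, countersigned by
audit-1 gen 12); tree form audit-1 gen 52.
[cite: VandenbergHaggstromKahn2005, Thm. 1.3 (p. 6)] [cite: KozmaNitzan2024, Conj. 1 (p. 3), Conj. 4 (p. 32), §4 Lemma 10 (pp. 17–22)]
-/

noncomputable section

namespace Summit.CriticalPhenomena.PercolationContinuityZ3.Theorems

open MeasureTheory Set
open Literature.Probability.LatticeModels (prodBernoulli)
open Literature.Probability.Percolation Literature.Probability.Percolation.KNPreFKG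

namespace CSH.Defect

/-- **Graded end-to-end additive stability from audit-1's boundary object, tolerance-bearing form**: if at every NON-DEGENERATE weight
function the decoy-free margin `CSH.s5dMargin p T r [] o v F` is `≥ −η` for every relay set with `|T| ≤ K`, observers `o, v ∉ T`,
`o ≠ v`, every monotone `F` WITH VALUES IN `[0,1]` and every injective `m`-compatible rank, then at EVERY weight function
`μ_w(o ↔ A) − t − η ≤ μ_w(o ↔ b)` whenever `|A| ≤ K + 1` and `t ≥ max_a μ_w(a ↮ b)` — constant 1 in front of `η`.
[cite: KozmaNitzan2024, Conj. 1 (p. 3)] -/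
theorem additiveGluing_card_defect_of_s5dMargin_defect01 (K : ℕ) (η : ℝ) (hη : 0 ≤ η)
    (h : ∀ (n : ℕ) (p : Sym2 (Fin n) → unitInterval), (∀ e, 0 < p e ∧ p e < 1) →
      ∀ (T : Finset (Fin n)) (o v : Fin n) (F : Set (Fin n) → ℝ) (r : Fin n → ℕ),
      T.card ≤ K → o ∉ T → v ∉ T → o ≠ v → (∀ S S' : Set (Fin n), S ⊆ S' → F S ≤ F S') → (∀ S, 0 ≤ F S) → (∀ S, F S ≤ 1) →
      Set.InjOn r ↑T →
      (∀ a ∈ T, ∀ a' ∈ T, r a < r a' →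
        ∫ ω, F (openCluster ω a) ∂(prodBernoulli p) ≤ ∫ ω, F (openCluster ω a') ∂(prodBernoulli p)) →
      -η ≤ s5dMargin p T r [] o v F) :
    ∀ (n : ℕ) (w : Sym2 (Fin n) → unitInterval) (A : Finset (Fin n)) (o b : Fin n) (t : ℝ), A.card ≤ K + 1 → 0 ≤ t →
      (∀ a ∈ A, 1 - t ≤ (prodBernoulli w).real (openConn a b)) →
      (prodBernoulli w).real (⋃ a ∈ A, openConn o a) - t - η ≤ (prodBernoulli w).real (openConn o b) := by
  intro n w A o b t hA ht hrel
  have hGen := AGloc.Defect.gen_firstRank_of_surplusTransfer_defect01 K η hη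
    (fun n w T o v F r hTK hvT hF hF0 hF1 hr hcompat =>
      surplusTransfer_of_nondegenerate_defect T o v F η
        (fun p hp r' hr' hc' => surplusTransfer_nondegenerate_of_s5dMargin_defect p hp T o v F r' η hη hvT hr' hc'
          fun hoT hov => h n p hp T o v F r' hTK hoT hvT hov hF hF0 hF1 hr' hc') w r hr hcompat)
  have hAG := AGloc.Defect.agloc_firstRank_of_gen_defect01 (K + 1) η hGen
  exact AGloc.Defect.additiveGluing_card_of_agloc_firstRank_defect (K + 1) η hAG n w A o b t hA ht hrel

/-- **End-to-end additive stability from audit-1's boundary object, tolerance-bearing form, all sizes**: if at every NON-DEGENERATE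
weight function `−η ≤ CSH.s5dMargin p T r [] o v F` for all relay sets, observers `o, v ∉ T`, `o ≠ v`, `[0,1]`-valued monotone `F` and
injective `m`-compatible ranks, then at EVERY weight function `μ_w(o ↔ A) − t − η ≤ μ_w(o ↔ b)` whenever `t ≥ max_a μ_w(a ↮ b)`:
constant 1, uniformly in `n`, `|A|`, `w`, `F` (the tolerance-bearing form of `additiveGluing_defect_of_s5dMargin_defect`).
[cite: KozmaNitzan2024, Conj. 1 (p. 3)] -/
theorem additiveGluing_defect_of_s5dMargin_defect01 (η : ℝ) (hη : 0 ≤ η)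
    (h : ∀ (n : ℕ) (p : Sym2 (Fin n) → unitInterval), (∀ e, 0 < p e ∧ p e < 1) →
      ∀ (T : Finset (Fin n)) (o v : Fin n) (F : Set (Fin n) → ℝ) (r : Fin n → ℕ),
      o ∉ T → v ∉ T → o ≠ v → (∀ S S' : Set (Fin n), S ⊆ S' → F S ≤ F S') → (∀ S, 0 ≤ F S) → (∀ S, F S ≤ 1) →
      Set.InjOn r ↑T →
      (∀ a ∈ T, ∀ a' ∈ T, r a < r a' →
        ∫ ω, F (openCluster ω a) ∂(prodBernoulli p) ≤ ∫ ω, F (openCluster ω a') ∂(prodBernoulli p)) →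
      -η ≤ s5dMargin p T r [] o v F) :
    ∀ (n : ℕ) (w : Sym2 (Fin n) → unitInterval) (A : Finset (Fin n)) (o b : Fin n) (t : ℝ), 0 ≤ t →
      (∀ a ∈ A, 1 - t ≤ (prodBernoulli w).real (openConn a b)) →
      (prodBernoulli w).real (⋃ a ∈ A, openConn o a) - t - η ≤ (prodBernoulli w).real (openConn o b) :=
  fun n w A o b t ht hrel =>
    additiveGluing_card_defect_of_s5dMargin_defect01 A.card η hη (fun n p hp T o v F r _ => h n p hp T o v F r)
      n w A o b t (Nat.le_succ _) ht hrel

/- Consistency at `η = 0` (an `example`, not a declaration): the restricted margin hypothesis is discharged by memo Theorem 2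
(`CSH.s5dMargin_nonneg_of_csh`, block (A)'s boundary theorem) and the crux `AdditiveGluing` comes back, as in
`CSH.additiveGluing_of_csh` (`…NoHeavyLowerTailCSHToS5.lean:39–47`). -/
example
    (hCSH : ∀ (n : ℕ) (w : Sym2 (Fin n) → unitInterval), (∀ e, 0 < w e ∧ w e < 1) →
      ∀ (o v x : Fin n) (Y : Finset (Fin n)) (D : List (Fin n)),
      o ≠ v → x ∉ Y → o ≠ x → v ≠ x → o ∉ Y → v ∉ Y → D.Nodup → (∀ d ∈ D, d ≠ x ∧ d ∉ Y ∧ d ≠ o ∧ d ≠ v) →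
      CSHHolds w x (↑Y : Set (Fin n)) D o v) :
    Summit.CriticalPhenomena.PercolationContinuityZ3.Theses.PercNearOneGluing.AdditiveGluing := by
  intro n w A o b t ht hab
  have h := additiveGluing_defect_of_s5dMargin_defect01 0 le_rfl
    (fun n p hp T o v F r hoT hvT hov hF _ _ hr hcompat => by
      have h0 := s5dMargin_nonneg_of_csh p hp o v (fun x Y D => hCSH n p hp o v x Y D hov) T r [] F hF hr hcompat hoT hvT
        List.nodup_nil (fun _ hd => absurd hd List.not_mem_nil)
      linarith)
    n w A o b t ht hab
  linarith

/-- **ε-relative CSH ⟹ additive gluing with slack `t + 2ε·(|A| − 1)`** (blocks (A) and (B) of the `θ(p_c) = 0` engine with a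
tolerance, end to end): the peel's depth factor `|T| ≤ |A| − 1` times `2ε` per relay, then constant 1 through the socket, the closure over
degenerate weights and (S5) ⟹ (GEN) ⟹ (AG-loc) ⟹ gluing. [cite: KozmaNitzan2024, Conj. 1 (p. 3)] -/
theorem additiveGluing_of_csh_relDefect (ε : ℝ) (hε : 0 ≤ ε)
    (hCSHε : ∀ (n : ℕ) (p : Sym2 (Fin n) → unitInterval), (∀ e, 0 < p e ∧ p e < 1) →
      ∀ (o v x : Fin n) (Y : Finset (Fin n)) (D : List (Fin n)),
      o ≠ v → x ∉ Y → o ≠ x → v ≠ x → o ∉ Y → v ∉ Y → D.Nodup → (∀ d ∈ D, d ≠ x ∧ d ∉ Y ∧ d ≠ o ∧ d ≠ v) →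
      ∀ f : Set (Sym2 (Fin n)) → ℝ, Monotone f → (∀ C, 0 ≤ f C) → (∀ C, f C ≤ 1) →
        -(ε * ((prodBernoulli p).real {ω : BondConfig (Fin n) | ∀ y ∈ (↑Y : Set (Fin n)), ¬ (openGraph ω).Reachable x y} *
            ∫ ω in {ω : BondConfig (Fin n) | ∀ y ∈ (↑Y : Set (Fin n)), ¬ (openGraph ω).Reachable x y},
              (1 - f (openEdgeCluster ω x)) ∂(prodBernoulli p))) ≤
          cshMargin p x (↑Y : Set (Fin n)) D o v f) :
    ∀ (n : ℕ) (w : Sym2 (Fin n) → unitInterval) (A : Finset (Fin n)) (o b : Fin n) (t : ℝ), 0 ≤ t →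
      (∀ a ∈ A, 1 - t ≤ (prodBernoulli w).real (openConn a b)) →
      (prodBernoulli w).real (⋃ a ∈ A, openConn o a) - t - 2 * ε * ((A.card - 1 : ℕ) : ℝ) ≤
        (prodBernoulli w).real (openConn o b) := by
  intro n w A o b t ht hrel
  rcases A.eq_empty_or_nonempty with hA0 | hne
  · subst hA0
    have h0 : (prodBernoulli w).real (⋃ a ∈ (∅ : Finset (Fin n)), openConn o a : Set (BondConfig (Fin n))) = 0 := by
      simp
    have hb : 0 ≤ (prodBernoulli w).real (openConn o b : Set (BondConfig (Fin n))) := measureReal_nonneg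
    rw [h0, Finset.card_empty, Nat.zero_sub, Nat.cast_zero, mul_zero, sub_zero]
    linarith
  obtain ⟨K, hK⟩ : ∃ K, A.card = K + 1 := ⟨A.card - 1, by have := Finset.card_pos.2 hne; omega⟩
  have hKc : ((A.card - 1 : ℕ) : ℝ) = K := by rw [hK, Nat.add_sub_cancel]
  have main := additiveGluing_card_defect_of_s5dMargin_defect01 K (2 * ε * K) (by positivity)
    (fun n p hp T o v F r hTK hoT hvT hov hF hF0 hF1 hr hcompat => by
      have h := s5dMargin_ge_of_csh_relDefect p hp o v ε hε
        (fun x Y D hxY hox hvx hoY hvY hD hDd f hf hf0 hf1 => hCSHε n p hp o v x Y D hov hxY hox hvx hoY hvY hD hDd f hf hf0 hf1)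
        T r [] F hF hF0 hF1 hr hcompat hoT hvT List.nodup_nil (fun _ hd => absurd hd List.not_mem_nil)
      have hTK' : 2 * ε * (T.card : ℝ) ≤ 2 * ε * (K : ℝ) :=
        mul_le_mul_of_nonneg_left (Nat.cast_le.2 hTK) (by positivity)
      linarith)
    n w A o b t (le_of_eq hK) ht hrel
  rw [hKc]
  exact main

end CSH.Defect

end Summit.CriticalPhenomena.PercolationContinuityZ3.Theorems

namespace Summit.CriticalPhenomena.PercolationContinuityZ3.Theorems.Quant

namespace Defect

open MeasureTheory Literature.Probability.LatticeModels Literature.Probability.Percolation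
  Literature.Probability.Percolation.KozmaNitzan Literature.Probability.Percolation.KNPreFKG

variable {d : ℕ}

/-- **TOL end to end, tolerance-bearing form**: if at every NON-DEGENERATE weight function on every `Fin n` the decoy-free (S5D)
margin `CSH.s5dMargin p T r [] o v F` is `≥ −η` (`η ≥ 0`; observers `o ∉ T`, `v ∉ T`, `o ≠ v`; monotone `F` WITH VALUES IN `[0,1]`;
injective `m`-compatible rank), then for every `p < 1`, `δ > 0`, geometry list `H` and scale data satisfying Kozma–Nitzan's hypotheses
(a)–(e) with margin `R`:  `TargetPropertyAt d p (7δ + η) δ H R`. [cite: KozmaNitzan2024, §4 Lemma 10 (pp. 17–22)] -/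
theorem targetPropertyAt_of_s5dMarginDefect01 [NeZero d] {η : ℝ} (hη : 0 ≤ η)
    (h : ∀ (n : ℕ) (p : Sym2 (Fin n) → unitInterval), (∀ e, 0 < p e ∧ p e < 1) →
      ∀ (T : Finset (Fin n)) (o v : Fin n) (F : Set (Fin n) → ℝ) (r : Fin n → ℕ),
      o ∉ T → v ∉ T → o ≠ v → (∀ S S' : Set (Fin n), S ⊆ S' → F S ≤ F S') → (∀ S, 0 ≤ F S) → (∀ S, F S ≤ 1) →
      Set.InjOn r ↑T →
      (∀ a ∈ T, ∀ a' ∈ T, r a < r a' →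
        ∫ ω, F (openCluster ω a) ∂(prodBernoulli p) ≤ ∫ ω, F (openCluster ω a') ∂(prodBernoulli p)) →
      -η ≤ CSH.s5dMargin p T r [] o v F)
    (p : unitInterval) (hp1 : (p : ℝ) < 1)
    {δ : ℝ} (hδ : 0 < δ) (H : List (Geom d)) {m M ℓmax k R : ℕ} (hmM : m < M)
    (hhit : ∀ g ∈ H, ∀ ℓ : ℕ, ℓmax ≤ ℓ →
      1 - δ ^ 2 < (bondPercolation (zdGraph d) p).real (linkIn (↑(g.Qset ℓ 0)) (box d m) (g.Fset ℓ 0)))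
    (hface : ∀ (a : Fin d) (τ : Fin d → ℤˣ),
      1 - δ ^ 2 < (bondPercolation (zdGraph d) p).real (linkEvent (box d m) (orthantFace a τ M) M))
    (huniq : 1 - δ ^ 2 < (bondPercolation (zdGraph d) p).real (uniqZone m M))
    (hk : (1 - (p : ℝ) ^ seedBound d M) ^ k ≤ δ)
    (hR : 3 * M + ℓmax + 4 + ⌈(1 / (1 - (p : ℝ)) ^ (2 * d * LData.Ncont d M k)) / δ⌉₊ ≤ R) :
    TargetPropertyAt d p (7 * δ + η) δ H R :=
  targetPropertyAt_of_additiveGluingDefect hη (CSH.Defect.additiveGluing_defect_of_s5dMargin_defect01 η hη h)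
    p hp1 hδ H hmM hhit hface huniq hk hR

end Defect

end Summit.CriticalPhenomena.PercolationContinuityZ3.Theorems.Quant

end
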